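import Summits.ResolutionOfSingularities.ResolutionOfSingularities.Theorems.HilbertSamuelEliminationSigmaMaxModificationsCorridor3WLadderE1GeneralPolynomial
import Summits.ResolutionOfSingularities.ResolutionOfSingularities.Theorems.HilbertSamuelEliminationSigmaMaxModificationsCorridor3WLadderE1GeneralSection
import Literature.RingTheory.HilbertSamuel.HilbertFunctionBaseChange
import Literature.RingTheory.HilbertSamuel.ProjDirectrixLiftsTransport
import Literature.RingTheory.HilbertSamuel.DirectrixLocal
import HarnessLib

/-!
# [OURS · L1 W4.2] The `e = 1` door OUTSIDE the hypersurface cell, step 3 — **TRANSVERSALITY OF THE EXCEPTIONAL PARAMETER PROPAGATES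
# ALONG A NEAR STEP, FOR AN ARBITRARY LOCAL RING** (no hypersurface datum, no standard bases)
# (crux `SigmaMaxModifications` stmt-ResolutionOfSingularities-18506 / conjunct stmt-…-19249, line `w_ladder_rows` v8.5, row `stub_twoClaims` (β);
# `--supports 19249`, helper)

Stub worker res-L1-w42-stub-3 (gen 6). Sorry-free PROOF file, no definition, no named fact. OURS bookkeeping for the W4.2 crux chain
(cell res-hironaka); NOT a statement of [Hironaka2017] nor of [CossartJannsenSaito2020]. AI-written; AI review is weaker than expert review.

THE FRAME (intrinsic, ring level). `φ : (A, 𝔪, k) → (A′, 𝔪′, k′)` a local homomorphism of Noetherian local rings with `k → k′` bijective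
(a RATIONAL point), generators `x` of `𝔪` and `y` of `𝔪′` indexed alike, an index `j` with `y_j = φ(x_j) =: t′` a NON-ZERO-DIVISOR and the
CHART RELATIONS `φ(x_k) = t′·y_k` (`k ≠ j`) — the local ring at the ORIGIN of the `x_j`-chart of the blow-up of `𝔪` — which is NEAR:
`H^{(0)}(A′) = H^{(0)}(A)`, and whose directrix downstairs is transversal to the chart: `𝒯(J_A(x)) ⊆ ⊕_{i ≠ j} k X_i` (this is what «the point lies
on `ℙ(Dir(A))`» gives at the origin, LEMMA O of `…E1TangentConeTransport`).

THE THEOREM `directrixDim_succ_le_of_X_mem_directrixSpace_of_near`: if the symbol `X_j` of `t′` lies in the directrix space `𝒯(J_{A′}(y))`, then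
`e(A′) + 1 ≤ e(A)`. Hence (`X_notMem_directrixSpace_of_near`) at `e(A) = 1 ≤ e(A′)` the slot `j` stays TRANSVERSAL at `A′` — the next near
point is again in the `t′`-chart: the `e = 1` near step is FREE, for every embedding dimension and every kernel.

THE MECHANISM (replacing CJS Thm. 9.3's standard bases by Hilbert functions): (1) the symbol forms of `A` not involving `X_j` map, under the chart
relations, to symbol forms of `B = A′/t′A′` (the exceptional fibre is the cone `C(A)/Dir` at its vertex), so `J_A·k″[X] + (X_j) ⊆ J_B(ȳ)`;
(2) `X_j` is a non-zero-divisor modulo `J_A·k″[X]` (directed by `⊕_{i≠j}`), so `Σ_{i≤s} H(J_A k″[X] + (X_j); i) = H^{(0)}_A(s)`; (3) with the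
tree's `H^{(0)}_{A′} ≤ H^{(1)}_B` and nearness, ALL inequalities are equalities: `J_B = J_A·k″[X] + (X_j)` and `H^{(1)}_B = H^{(0)}_{A′}`; (4) the
latter makes `in(t′)` superficial-regular (`…E1GeneralSection`), so `J_B = J_{A′}·k″[X] + (X_j)` too; (5) the directrix reduction
(`…E1GeneralPolynomial`) on `J_{A′}·k″[X] + (X_j) = J_A·k″[X] + (X_j)`.

[OURS · L1 W4.2; AI-written] [cite: CossartJannsenSaito2020, Lemma 2.7, Def. 2.8, §2.2 (p. 27), Def. 6.34 (i), Thm. 3.10 (3.14)]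
[cite: HerrmannIkedaOrbanz1988, Thm. (22.24)]
-/

set_option linter.dupNamespace false

noncomputable section

open IsLocalRing MvPolynomial Finset
open Literature.RingTheory.MvPolynomial Literature.RingTheory.HilbertSamuel

namespace Summit.ResolutionOfSingularities.ResolutionOfSingularities.Theorems.SigmaMaxModificationsCorridor3.E1Free

universe u

/-! ## Small helpers -/

/-- The variables of a homogeneous component are among the variables of the polynomial. [folklore] -/
theorem vars_homogeneousComponent_subset {σ R : Type*} [CommSemiring R] [DecidableEq σ] (n : ℕ) (p : MvPolynomial σ R) :
    (homogeneousComponent n p).vars ⊆ p.vars := by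
  intro i hi
  rw [mem_vars_iff_mem_support] at hi ⊢
  obtain ⟨μ, hμ, hiμ⟩ := hi
  refine ⟨μ, ?_, hiμ⟩
  rw [mem_support_iff, coeff_homogeneousComponent] at hμ
  rw [mem_support_iff]
  intro h0
  apply hμ
  split_ifs <;> simp [h0]

/-- A homogeneous component of a polynomial not involving `X_j` does not involve `X_j`. [folklore] -/
theorem homogeneousComponent_mem_supported {σ R : Type*} [CommSemiring R] {s : Set σ} {p : MvPolynomial σ R}
    (hp : p ∈ supported R s) (n : ℕ) : homogeneousComponent n p ∈ supported R s := by
  classical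
  rw [mem_supported] at hp ⊢
  exact (Finset.coe_subset.mpr (vars_homogeneousComponent_subset n p)).trans hp

/-- **The chart evaluation**: if `x'_k = t·y_k` for `k ≠ j` and the coefficient vector `c` is supported on monomials without `X_j`, then
`Σ_μ c_μ x'^μ = t^m · Σ_μ c_μ y^μ`. [folklore] -/
theorem evalMonomials_eq_pow_mul_of_chart {R : Type u} [CommRing R] {d m : ℕ} (x' y : Fin d → R) (t : R) (j : Fin d)
    (hchart : ∀ k, k ≠ j → x' k = t * y k) (c : monomialsOfDegree d m →₀ R) (hc : ∀ μ ∈ c.support, μ.1 j = 0) :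
    evalMonomials x' m c = t ^ m * evalMonomials y m c := by
  classical
  rw [evalMonomials, evalMonomials, Finsupp.linearCombination_apply, Finsupp.linearCombination_apply, Finsupp.sum, Finsupp.sum,
    Finset.mul_sum]
  refine Finset.sum_congr rfl fun μ hμ => ?_
  have hprod : ∏ i, x' i ^ μ.1 i = t ^ m * ∏ i, y i ^ μ.1 i := by
    have h1 : ∏ i, x' i ^ μ.1 i = ∏ i, (t * y i) ^ μ.1 i := by
      refine Finset.prod_congr rfl fun i _ => ?_
      by_cases hi : i = j
      · subst hi; rw [hc μ hμ, pow_zero, pow_zero]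
      · rw [hchart i hi]
    rw [h1]
    simp_rw [mul_pow]
    rw [Finset.prod_mul_distrib, Finset.prod_pow_eq_pow_sum]
    congr 2
    have h2 : (μ.1).degree = m := μ.2
    exact (Finsupp.degree_eq_sum μ.1).symm.trans h2
  rw [smul_eq_mul, smul_eq_mul, hprod]
  ring

/-! ## Step 1: the symbol forms of `A` off `X_j` become symbol forms of `B = A′/t′A′` -/

section Containment

variable {A A' : Type u} [CommRing A] [IsLocalRing A] [CommRing A'] [IsLocalRing A']
  {d : ℕ} {x : Fin d → A} (hx : Ideal.span (Set.range x) = maximalIdeal A)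
  {y : Fin d → A'} (hy : Ideal.span (Set.range y) = maximalIdeal A') (j : Fin d)
  (φ : A →+* A') [IsLocalHom φ]
  [IsLocalRing (A' ⧸ Ideal.span {y j})] [IsLocalHom (algebraMap A' (A' ⧸ Ideal.span {y j}))]

/-- **A symbol form of `A` not involving `X_j` maps to a symbol form of `B = A′/(t′)`** under `k → k′ → k″`: by the chart relations
`φ(F̃(x)) = t′^m F̃^φ(y)` while `φ(𝔪^{m+1}) ⊆ (t′)^{m+1}`, so (cancelling the non-zero-divisor `t′^m`) `F̃^φ(y) ∈ (t′)` vanishes in `B`.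
[OURS · L1 W4.2; AI-written] [cite: CossartJannsenSaito2020, §2.2 (p. 27), Def. 6.34 (i)] -/
theorem map_mem_tangentConeIdeal_quotient_of_chart (hyj : y j = φ (x j)) (hchart : ∀ k, k ≠ j → φ (x k) = φ (x j) * y k)
    (hnzd : φ (x j) ∈ nonZeroDivisors A') {m : ℕ} {F : MvPolynomial (Fin d) (ResidueField A)} (hF : F ∈ symbolForms x hx m)
    (hFs : F ∈ supported (ResidueField A) {i | i ≠ j}) :
    MvPolynomial.map ((ResidueField.map (algebraMap A' (A' ⧸ Ideal.span {y j}))).comp (ResidueField.map φ)) F ∈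
      tangentConeIdeal (fun i => algebraMap A' (A' ⧸ Ideal.span {y j}) (y i))
        (span_range_algebraMap_eq (map_maximalIdeal_algebraMap_quotient_eq y j) y hy) := by
  classical
  have ht'0 : algebraMap A' (A' ⧸ Ideal.span {y j}) (φ (x j)) = 0 := by
    rw [← hyj, Ideal.Quotient.algebraMap_eq, Ideal.Quotient.eq_zero_iff_mem]; exact Ideal.mem_span_singleton_self _
  set B := A' ⧸ Ideal.span {y j} with hB
  set mkB : A' →+* B := algebraMap A' B with hmkB
  set hyB := span_range_algebraMap_eq (map_maximalIdeal_algebraMap_quotient_eq y j) y hy with hhyB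
  set t' := φ (x j) with ht'
  -- a lift of the coefficient vector supported where `F` is
  obtain ⟨cbar, hcbar, rfl⟩ := (mem_symbolForms_iff x hx).mp hF
  obtain ⟨s, hs⟩ : ∃ s : ResidueField A → A, ∀ a, residue A (s a) = a :=
    ⟨Function.surjInv Ideal.Quotient.mk_surjective, Function.surjInv_eq Ideal.Quotient.mk_surjective⟩
  let s₀ : ResidueField A → A := fun a => if a = 0 then 0 else s a
  have hs₀0 : s₀ 0 = 0 := if_pos rfl
  have hs₀ : ∀ a, residue A (s₀ a) = a := fun a => by
    by_cases ha : a = 0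
    · subst ha; rw [hs₀0, map_zero]
    · change residue A (if a = 0 then 0 else s a) = a
      rw [if_neg ha, hs a]
  set c : monomialsOfDegree d m →₀ A := Finsupp.mapRange s₀ hs₀0 cbar with hcdef
  have hcoeff : coeffResidue m c = cbar := by
    ext μ
    rw [coeffResidue_apply, hcdef, Finsupp.mapRange_apply, hs₀]
  have hcsupp : ∀ μ ∈ c.support, μ.1 j = 0 := by
    intro μ hμ
    have hμ' : cbar μ ≠ 0 := by
      have := Finsupp.support_mapRange (f := s₀) (hf := hs₀0) (g := cbar) hμ
      exact Finsupp.mem_support_iff.mp this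
    by_contra hj
    have hjvars : j ∈ (toForm m cbar).vars := by
      rw [mem_vars_iff_mem_support]
      refine ⟨μ.1, ?_, Finsupp.mem_support_iff.mpr hj⟩
      rw [mem_support_iff, coeff_toForm]
      exact hμ'
    exact (mem_supported.mp hFs) hjvars rfl
  -- the symbol-form condition downstairs, pushed through the chart
  have hev : evalMonomials x m c ∈ maximalIdeal A ^ (m + 1) :=
    (coeffResidue_mem_ker_symbolMap_iff x hx m c).mp (by rw [hcoeff]; exact hcbar)
  set cφ : monomialsOfDegree d m →₀ A' := Finsupp.mapRange φ (map_zero φ) c with hcφ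
  have hcφsupp : ∀ μ ∈ cφ.support, μ.1 j = 0 := fun μ hμ =>
    hcsupp μ (Finsupp.support_mapRange (f := φ) (hf := map_zero φ) (g := c) hμ)
  have hchart' : ∀ k, k ≠ j → (fun i => φ (x i)) k = t' * y k := fun k hk => hchart k hk
  have hφev : φ (evalMonomials x m c) = t' ^ m * evalMonomials y m cφ := by
    rw [map_evalMonomials, ← hcφ]
    exact evalMonomials_eq_pow_mul_of_chart (fun i => φ (x i)) y t' j hchart' cφ hcφsupp
  have hmaple : (maximalIdeal A).map φ ≤ Ideal.span {t'} := by
    rw [← hx, Ideal.map_span, Ideal.span_le]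
    rintro _ ⟨_, ⟨k, rfl⟩, rfl⟩
    by_cases hk : k = j
    · subst hk; exact Ideal.mem_span_singleton_self _
    · rw [SetLike.mem_coe, hchart k hk]; exact Ideal.mul_mem_right _ _ (Ideal.mem_span_singleton_self _)
  have hmem : t' ^ m * evalMonomials y m cφ ∈ Ideal.span {t' ^ (m + 1)} := by
    rw [← hφev, ← Ideal.span_singleton_pow]
    have h1 := Ideal.mem_map_of_mem φ hev
    rw [Ideal.map_pow] at h1
    exact Ideal.pow_right_mono hmaple _ h1
  obtain ⟨b, hb⟩ := Ideal.mem_span_singleton'.mp hmem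
  have hE : evalMonomials y m cφ = t' * b := by
    have h0 : t' ^ m * (evalMonomials y m cφ - t' * b) = 0 := by
      rw [mul_sub, ← hb]; ring
    exact sub_eq_zero.mp ((pow_mem hnzd m).1 _ h0)
  -- hence the symbol-form condition in `B`
  have hevB : evalMonomials (fun i => mkB (y i)) m (Finsupp.mapRange mkB (map_zero mkB) cφ) ∈ maximalIdeal B ^ (m + 1) := by
    rw [← map_evalMonomials, hE, map_mul]
    have h0 : mkB t' = 0 := ht'0
    rw [h0, zero_mul]
    exact zero_mem _
  have hkerB := (coeffResidue_mem_ker_symbolMap_iff (fun i => mkB (y i)) hyB m (Finsupp.mapRange mkB (map_zero mkB) cφ)).mpr hevB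
  have hformB : toForm m (coeffResidue m (Finsupp.mapRange mkB (map_zero mkB) cφ)) ∈ symbolForms (fun i => mkB (y i)) hyB m :=
    (mem_symbolForms_iff _ hyB).mpr ⟨_, hkerB, rfl⟩
  -- identify with `map κ F`
  have hvec : Finsupp.mapRange ((ResidueField.map mkB).comp (ResidueField.map φ)) (map_zero _) (coeffResidue m c) =
      coeffResidue m (Finsupp.mapRange mkB (map_zero mkB) cφ) := by
    ext μ
    simp only [Finsupp.mapRange_apply, coeffResidue_apply, hcφ, RingHom.comp_apply, ResidueField.map_residue]
  have hident : MvPolynomial.map ((ResidueField.map mkB).comp (ResidueField.map φ)) (toForm m cbar) =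
      toForm m (coeffResidue m (Finsupp.mapRange mkB (map_zero mkB) cφ)) := by
    rw [← hcoeff, map_toForm, hvec]
  rw [hident]
  exact mem_tangentConeIdeal_of_mem_symbolForms _ hyB m hformB

/-- **`J_A(x)·k″[X] ⊆ J_B(ȳ)`** when `𝒯(J_A(x)) ⊆ ⊕_{i≠j} k X_i`: `J_A` is generated by its symbol forms off `X_j` (CJS Lemma 2.7 + homogeneity),
and those map to symbol forms of `B` (`map_mem_tangentConeIdeal_quotient_of_chart`). [OURS · L1 W4.2; AI-written]
[cite: CossartJannsenSaito2020, Lemma 2.7, §2.2 (p. 27)] -/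
theorem map_tangentConeIdeal_le_quotient_of_chart (hyj : y j = φ (x j)) (hchart : ∀ k, k ≠ j → φ (x k) = φ (x j) * y k)
    (hnzd : φ (x j) ∈ nonZeroDivisors A')
    (hT : directrixSpace (tangentConeIdeal x hx) ≤ Submodule.span (ResidueField A) (X '' {i | i ≠ j})) :
    (tangentConeIdeal x hx).map
        (MvPolynomial.map ((ResidueField.map (algebraMap A' (A' ⧸ Ideal.span {y j}))).comp (ResidueField.map φ))) ≤
      tangentConeIdeal (fun i => algebraMap A' (A' ⧸ Ideal.span {y j}) (y i))
        (span_range_algebraMap_eq (map_maximalIdeal_algebraMap_quotient_eq y j) y hy) := by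
  classical
  have hdir : Directs (tangentConeIdeal x hx) (Submodule.span (ResidueField A) (X '' {i | i ≠ j})) :=
    (directs_directrixSpace _).of_le hT (span_X_le_one _)
  have hgen := (directs_span_X_iff _).mp hdir
  refine (Ideal.map_mono hgen).trans ?_
  rw [Ideal.map_span]
  refine Ideal.span_le.mpr ?_
  rintro _ ⟨G, ⟨hGJ, hGs⟩, rfl⟩
  rw [SetLike.mem_coe] at hGJ
  -- decompose `G` into its homogeneous components, each a symbol form off `X_j`
  rw [SetLike.mem_coe, ← sum_homogeneousComponent G, map_sum]
  refine Ideal.sum_mem _ fun m _ => ?_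
  have hGm : homogeneousComponent m G ∈ symbolForms x hx m := by
    rw [← idealDegree_tangentConeIdeal]
    exact ⟨isHomogeneousIdeal_tangentConeIdeal x hx G hGJ m, homogeneousComponent_isHomogeneous m G⟩
  exact map_mem_tangentConeIdeal_quotient_of_chart hx hy j φ hyj hchart hnzd hGm (homogeneousComponent_mem_supported hGs m)

end Containment

/-! ## Step 2: the theorem -/

section Main

variable {A A' : Type u} [CommRing A] [IsLocalRing A] [IsNoetherianRing A] [CommRing A'] [IsLocalRing A'] [IsNoetherianRing A']
  {d : ℕ} {x : Fin d → A} (hx : Ideal.span (Set.range x) = maximalIdeal A)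
  {y : Fin d → A'} (hy : Ideal.span (Set.range y) = maximalIdeal A') (j : Fin d)
  (φ : A →+* A') [IsLocalHom φ]

/-- **TRANSVERSALITY PROPAGATES ALONG A NEAR STEP, ARBITRARY LOCAL RING** (module docstring): in the frame `(φ, x, y, j)` with `y_j = φ(x_j)`
a non-zero-divisor, chart relations `φ(x_k) = φ(x_j)·y_k`, residue fields matched by `φ`, `H^{(0)}(A′) = H^{(0)}(A)` and
`𝒯(J_A(x)) ⊆ ⊕_{i≠j} k X_i`: if `X_j ∈ 𝒯(J_{A′}(y))` then `e(A′) + 1 ≤ e(A)` (directrix dimensions of the tangent-cone ideals).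
[OURS · L1 W4.2; AI-written] [cite: CossartJannsenSaito2020, Lemma 2.7, Def. 2.8, Def. 6.34 (i), Thm. 3.10 (3.14)]
[cite: HerrmannIkedaOrbanz1988, Thm. (22.24)] -/
theorem directrixDim_succ_le_of_X_mem_directrixSpace_of_near (hyj : y j = φ (x j))
    (hchart : ∀ k, k ≠ j → φ (x k) = φ (x j) * y k) (hnzd : φ (x j) ∈ nonZeroDivisors A')
    (hκ : Function.Bijective (ResidueField.map φ)) (hH : ∀ s, hilbertFun A' s = hilbertFun A s)
    (hT : directrixSpace (tangentConeIdeal x hx) ≤ Submodule.span (ResidueField A) (X '' {i | i ≠ j}))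
    (hXj : (X j : MvPolynomial (Fin d) (ResidueField A')) ∈ directrixSpace (tangentConeIdeal y hy)) :
    directrixDim (tangentConeIdeal y hy) + 1 ≤ directrixDim (tangentConeIdeal x hx) := by
  classical
  -- the quotient `B = A′/(t′)` is a Noetherian local ring, `A′ → B` local with matched residue fields
  have hym : ∀ i, y i ∈ maximalIdeal A' := fun i => hy ▸ Ideal.subset_span ⟨i, rfl⟩
  have ht'm : y j ∈ maximalIdeal A' := hym j
  have hne : Ideal.span {y j} ≠ ⊤ := by
    rw [Ne, Ideal.span_singleton_eq_top]; exact (IsLocalRing.mem_maximalIdeal _).mp ht'm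
  haveI : Nontrivial (A' ⧸ Ideal.span {y j}) := Ideal.Quotient.nontrivial_iff.mpr hne
  haveI : IsLocalRing (A' ⧸ Ideal.span {y j}) := IsLocalRing.of_surjective' _ Ideal.Quotient.mk_surjective
  have hmk : Function.Surjective (algebraMap A' (A' ⧸ Ideal.span {y j})) := by
    rw [Ideal.Quotient.algebraMap_eq]; exact Ideal.Quotient.mk_surjective
  haveI : IsLocalHom (algebraMap A' (A' ⧸ Ideal.span {y j})) := IsLocalHom.of_surjective _ hmk
  have hyj0 : algebraMap A' (A' ⧸ Ideal.span {y j}) (y j) = 0 := by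
    rw [Ideal.Quotient.algebraMap_eq, Ideal.Quotient.eq_zero_iff_mem]; exact Ideal.mem_span_singleton_self _
  set B := A' ⧸ Ideal.span {y j} with hB
  set mkB : A' →+* B := algebraMap A' B with hmkB
  set hyB := span_range_algebraMap_eq (map_maximalIdeal_algebraMap_quotient_eq y j) y hy with hhyB
  set κ'' : ResidueField A' →+* ResidueField B := ResidueField.map mkB with hκ''
  set κ : ResidueField A →+* ResidueField A' := ResidueField.map φ with hκdef
  have hκ''b : Function.Bijective κ'' := by
    refine ⟨κ''.injective, fun z => ?_⟩
    obtain ⟨b, rfl⟩ := residue_surjective z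
    obtain ⟨a, rfl⟩ := hmk b
    exact ⟨residue A' a, by rw [hκ'', ResidueField.map_residue]⟩
  have hκtot : Function.Bijective (κ''.comp κ) := hκ''b.comp hκ
  -- the ideals
  set J := tangentConeIdeal x hx with hJ
  set J' := tangentConeIdeal y hy with hJ'
  set J'' := tangentConeIdeal (fun i => mkB (y i)) hyB with hJ''
  set Ish := J.map (MvPolynomial.map (κ''.comp κ)) with hIsh
  set Imap := J'.map (MvPolynomial.map κ'') with hImap
  set Xj : MvPolynomial (Fin d) (ResidueField B) := X j with hXjdef
  -- Step 1: `Ish + (X_j) ≤ J''` and `Imap ≤ J''`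
  have hXjJ'' : Xj ∈ J'' := by
    refine mem_tangentConeIdeal_of_mem_symbolForms _ hyB 1 ((mem_symbolForms_iff_exists_form _ hyB).mpr ⟨X j, isHomogeneous_X _ j, ?_, map_X _ j⟩)
    rw [eval_X]
    have h0 : mkB (y j) = 0 := hyj0
    rw [h0]; exact zero_mem _
  have hIshle : Ish ≤ J'' := map_tangentConeIdeal_le_quotient_of_chart hx hy j φ hyj hchart hnzd hT
  have hJshle : Ish ⊔ Ideal.span {Xj} ≤ J'' := sup_le hIshle (by rw [Ideal.span_singleton_le_iff_mem]; exact hXjJ'')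
  have hImaple : Imap ≤ J'' := map_tangentConeIdeal_le (map_maximalIdeal_algebraMap_quotient_eq y j) y hy
  -- Step 2: Hilbert functions
  have hHA : hilbertFunQuot (ResidueField B) d Ish = hilbertFun A := by
    rw [hIsh, hilbertFunQuot_map _ (isHomogeneousIdeal_tangentConeIdeal x hx)]
    exact hilbertFunQuot_tangentConeIdeal x hx
  have hHB : hilbertFunQuot (ResidueField B) d J'' = hilbertFun B := hilbertFunQuot_tangentConeIdeal _ hyB
  have hdirJ : Directs J (Submodule.span (ResidueField A) (X '' {i | i ≠ j})) :=
    (directs_directrixSpace _).of_le hT (span_X_le_one _)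
  have hdirsh : Directs Ish (Submodule.span (ResidueField B) (X '' {i | i ≠ j})) := directs_span_X_map _ _ hdirJ
  have hnzdX : ∀ f, Xj * f ∈ Ish → f ∈ Ish := fun f hf => (X_mul_mem_iff_of_directs' j hdirsh f).mp hf
  have hhomsh : IsHomogeneousIdeal Ish := isHomogeneousIdeal_map _ (isHomogeneousIdeal_tangentConeIdeal x hx)
  -- values at `0`
  have hanti : ∀ i, hilbertFunQuot (ResidueField B) d J'' i ≤ hilbertFunQuot (ResidueField B) d (Ish ⊔ Ideal.span {Xj}) i :=
    fun i => hilbert_antitone hJshle i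
  have hanti' : ∀ i, hilbertFunQuot (ResidueField B) d (Ish ⊔ Ideal.span {Xj}) i ≤ hilbertFunQuot (ResidueField B) d Ish i :=
    fun i => hilbert_antitone le_sup_left i
  have h0 : hilbertFunQuot (ResidueField B) d (Ish ⊔ Ideal.span {Xj}) 0 = hilbertFunQuot (ResidueField B) d Ish 0 := by
    refine le_antisymm (hanti' 0) ?_
    have h1 : hilbertFunQuot (ResidueField B) d Ish 0 = 1 := by rw [hHA, hilbertFun_zero]
    have h2 : hilbertFunQuot (ResidueField B) d J'' 0 = 1 := by rw [hHB, hilbertFun_zero]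
    rw [h1, ← h2]; exact hanti 0
  have htele : ∀ s, ∑ i ∈ range (s + 1), hilbertFunQuot (ResidueField B) d (Ish ⊔ Ideal.span {Xj}) i = hilbertFun A' s := by
    intro s
    rw [hH s, ← hHA]
    exact sum_hilbertFunQuot_sup_span_eq hhomsh (isHomogeneous_X _ j) (X_ne_zero j) hnzdX h0 s
  -- the tree's inequality `H^{(0)}_{A'} ≤ H^{(1)}_B` and the sandwich
  have hineq : ∀ s, hilbertFun A' s ≤ ∑ i ∈ range (s + 1), hilbertFun B i := by
    intro s
    have h1 := hilbertFun_le_hilbertSamuelFun_one_quotient (A := A') ht'm s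
    rwa [hilbertSamuelFun_succ_apply, hilbertSamuelFun_zero] at h1
  have hsumle : ∀ s, ∑ i ∈ range (s + 1), hilbertFun B i ≤
      ∑ i ∈ range (s + 1), hilbertFunQuot (ResidueField B) d (Ish ⊔ Ideal.span {Xj}) i := by
    intro s
    refine Finset.sum_le_sum fun i _ => ?_
    rw [← hHB]; exact hanti i
  have hsumeq : ∀ s, ∑ i ∈ range (s + 1), hilbertFun B i = hilbertFun A' s :=
    fun s => le_antisymm ((hsumle s).trans (htele s).le) (hineq s)
  -- (a) `H^{(1)}_B = H^{(0)}_{A'}`: `in(t')` is superficial-regular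
  have hHS : ∀ s, hilbertSamuelFun B 1 s = hilbertFun A' s := by
    intro s; rw [hilbertSamuelFun_succ_apply, hilbertSamuelFun_zero]; exact hsumeq s
  have hinj : ∀ (s : ℕ) (a : A'), y j * a ∈ maximalIdeal A' ^ (s + 1) → a ∈ maximalIdeal A' ^ s :=
    fun s a ha => mem_pow_of_mul_mem_pow_succ_of_hilbertFun_eq hHS s ha
  -- (b) `J'' = Ish + (X_j)`: containment with equal Hilbert functions
  have hptw : ∀ i, hilbertFunQuot (ResidueField B) d (Ish ⊔ Ideal.span {Xj}) i = hilbertFunQuot (ResidueField B) d J'' i := by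
    intro i
    have hs := (hsumle i).antisymm ((htele i).trans (hsumeq i).symm).le
    -- the sums over `range (i+1)` agree and the terms are ordered, so the `i`-th terms agree
    have hzero : ∑ l ∈ range (i + 1), (hilbertFunQuot (ResidueField B) d (Ish ⊔ Ideal.span {Xj}) l - hilbertFun B l) = 0 := by
      rw [Finset.sum_tsub_distrib _ (fun l _ => by rw [← hHB]; exact hanti l), ← hs, Nat.sub_self]
    have hl := (Finset.sum_eq_zero_iff.mp hzero) i (Finset.self_mem_range_succ i)
    rw [hHB]
    have := hanti i
    rw [hHB] at this
    omega
  have hdeg : ∀ i, idealDegree (Ish ⊔ Ideal.span {Xj}) i = idealDegree J'' i := by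
    intro i
    refine Submodule.eq_of_le_of_finrank_le (idealDegree_mono hJshle i) ?_
    have h1 := hptw i
    unfold hilbertFunQuot at h1
    have h2 := finrank_idealDegree_le (Ish ⊔ Ideal.span {Xj}) i
    have h3 := finrank_idealDegree_le J'' i
    omega
  have hJ''eq : J'' = Ish ⊔ Ideal.span {Xj} := by
    refine le_antisymm ?_ hJshle
    conv_lhs => rw [hJ'', tangentConeIdeal]
    rw [Ideal.span_le]
    intro F hF
    obtain ⟨m, hFm⟩ := Set.mem_iUnion.mp hF
    rw [SetLike.mem_coe, ← idealDegree_tangentConeIdeal] at hFm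
    change F ∈ idealDegree J'' m at hFm
    rw [← hdeg m] at hFm
    exact hFm.1
  -- (c) `J'' = Imap + (X_j)` from superficial regularity
  have hImapeq : Imap ⊔ Ideal.span {Xj} = J'' := by
    refine le_antisymm (sup_le hImaple (by rw [Ideal.span_singleton_le_iff_mem]; exact hXjJ'')) ?_
    exact tangentConeIdeal_quotient_le_map_sup_span_X y hy j hinj
  -- (d) the directrix reduction
  have heq : Imap ⊔ Ideal.span {Xj} = Ish ⊔ Ideal.span {Xj} := hImapeq.trans hJ''eq
  have hXmem : Xj ∈ directrixSpace Imap := by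
    rw [← SetLike.mem_coe, hImap, hJ', coe_directrixSpace_map_of_bijective κ'' hκ''b]
    exact ⟨X j, hXj, map_X _ j⟩
  have hred := directrixDim_succ_le_of_sup_span_X_eq j hdirsh heq hXmem
  rw [hImap, hJ', directrixDim_map_eq_of_bijective κ'' hκ''b, hIsh, hJ, directrixDim_map_eq_of_bijective _ hκtot] at hred
  exact hred

/-- **THE `e = 1` NEAR STEP IS FREE, EVERY EMBEDDING DIMENSION, EVERY KERNEL**: in the frame of
`directrixDim_succ_le_of_X_mem_directrixSpace_of_near`, if `e(A) = 1 ≤ e(A′)` then the symbol `X_j` of the exceptional parameter `t′` is OFF the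
directrix space of `A′` (so the NEXT near point lies in the `t′`-chart again). [OURS · L1 W4.2; AI-written]
[cite: CossartJannsenSaito2020, Def. 6.34 (i), Lemma 2.7, Thm. 9.3] -/
theorem X_notMem_directrixSpace_of_near (hyj : y j = φ (x j))
    (hchart : ∀ k, k ≠ j → φ (x k) = φ (x j) * y k) (hnzd : φ (x j) ∈ nonZeroDivisors A')
    (hκ : Function.Bijective (ResidueField.map φ)) (hH : ∀ s, hilbertFun A' s = hilbertFun A s)
    (hT : directrixSpace (tangentConeIdeal x hx) ≤ Submodule.span (ResidueField A) (X '' {i | i ≠ j}))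
    (he : directrixDim (tangentConeIdeal x hx) ≤ 1) (he' : 1 ≤ directrixDim (tangentConeIdeal y hy)) :
    (X j : MvPolynomial (Fin d) (ResidueField A')) ∉ directrixSpace (tangentConeIdeal y hy) := by
  intro hXj
  have h := directrixDim_succ_le_of_X_mem_directrixSpace_of_near hx hy j φ hyj hchart hnzd hκ hH hT hXj
  omega

end Main

end Summit.ResolutionOfSingularities.ResolutionOfSingularities.Theorems.SigmaMaxModificationsCorridor3.E1Free

end
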